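import Mathlib.Topology.Algebra.Group.Basic   -- `IsTopologicalGroup.isOpenMap_iff_nhds_one`
import HarnessLib

/-!
# K2 ∕ E5 «TamagawaUnitary», unit HAAR-FIBRATION — FILE `K2E5HaarIsOpenMapOfSection`: a continuous homomorphism with a
# continuous homomorphic section is an open map (socket `HaarFibration.sig_K2E5HaarIsOpenMapOfSection` BY NAME)

Cell `hodgecm-mathlib` (Track B «K2-LIT»), item h413 = `stmt-HodgeConjecture-24833`, route of record
`route-HodgeConjecture-HCCMUnconditional`; tier-0 line `Cruxes/H413/Lines/K2_E5_TamagawaUnitary.lean` (ED. 2), tier-1 socket module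
`Cruxes/H413/Lines/K2_E5_TamagawaUnitary_HaarFibration.lean` (K2E5-plan (g0), sha16 d824e6f5f5dc21bf), socket
`Summit.HodgeConjecture.HodgeConjecture.Cruxes.H413.K2E5TamagawaUnitary.HaarFibration.sig_K2E5HaarIsOpenMapOfSection` (:37, size S — the
FIRST link of the chain `IsOpenMapOfSection → KerLiftHomeomorph → QuotientIsHaar → MapKerLiftIsHaar → KerPinRescale` = generic form of the
tier-0 stub `stub_detFibrationPin`; instantiated later with `φ = det : U(h)(𝔸) → U(1)(𝔸)` and its diagonal section).  PROOF lane (theorems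
only); author K2E5-p01 (g0).  Per the cell protocol the Lines module is NOT imported: the TYPE of `isOpenMapOfSection` below is the socket's
statement token for token, and the by-name fold `theorem sig_K2E5HaarIsOpenMapOfSection : … := K2E5HaarIsOpenMapOfSection.isOpenMapOfSection`
goes into the socket module at its next edition (kernel certificate of the token identity at home:
`K2/K2E5-p01/g0/Probe_K2E5HaarIsOpenMapOfSection.lean`, `example : type_of% @… = type_of% @… := rfl`).

Content.  Let `φ : G →* Q` be a homomorphism of topological groups admitting a CONTINUOUS HOMOMORPHIC SECTION `s : Q →* G`,
`φ (s q) = q`.  Then `φ` is an open map.  Printed form: Vignéras, *Arithmétique des algèbres de quaternions*, Ch. II §4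
(«Mesures compatibles»: an exact sequence `1 → Y → Z →φ T → 1` of locally compact groups with continuous maps, used with a section to
split Haar measures `dz = dy dt`) and Deitmar–Echterhoff Thm. 1.5.3 (open-mapping ∕ quotient calculus for `G → G⧸N`).
PROOF STRATEGY (Mathlib reuse first, differs from the pointwise «twist `y ↦ s(y·y₀⁻¹)·u₀`» argument of the socket docstring): by Mathlib's
`IsTopologicalGroup.isOpenMap_iff_nhds_one` a homomorphism out of a topological group is open iff `𝓝 1 ≤ map φ (𝓝 1)`; and
`𝓝 1 = map (φ ∘ s) (𝓝 1) = map φ (map s (𝓝 1)) ≤ map φ (𝓝 (s 1)) = map φ (𝓝 1)` because `s` is continuous with `s 1 = 1`.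
Continuity of `φ` (a binder of the frozen socket) is not needed for openness and is carried unused.

HONEST LABEL: HC_CM is proved only modulo the 7 printed citations (2 remaining named inputs: hLiu418 = stmt-HodgeConjecture-24832,
h413 = stmt-HodgeConjecture-24833) until rung 0 closes; this file closes ONE size-S socket of ONE tier-1 unit and discharges none of them.

AUDIT (materialised pages; corpus key `book:vignerasnd-arithmetique-des-algebres-de-quaternions` = V80, chunk p0048 = printed Ch. II §4):
V80 p0048.txt:L21 «suite exacte de groupes topologiques … continues»; p0048.txt:L25 «On dit que les mesures dy , dz , dt sont compatibles avec
cette suite, ou encorc que dz = dy dt».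

## References
* [VignerasLNM800] M.-F. Vignéras, *Arithmétique des algèbres de quaternions*, Lecture Notes in Math. 800, Springer 1980 — Ch. II §4
  («Mesures compatibles»).
* [DeitmarEchterhoff2014] A. Deitmar, S. Echterhoff, *Principles of Harmonic Analysis*, 2nd ed., Universitext, Springer 2014 — Thm. 1.5.3.
-/

set_option autoImplicit false
set_option linter.dupNamespace false

namespace Summit.HodgeConjecture.HodgeConjecture.Cruxes.H413.K2E5HaarIsOpenMapOfSection

open Filter Topology

/-- **Neighbourhood form.**  If a monoid homomorphism `φ : G →* Q` between topological groups has a continuous section `s : Q →* G`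
(`φ (s q) = q` for all `q`), then every neighbourhood of `1 : Q` is the image under `φ` of a neighbourhood of `1 : G`, i.e.
`𝓝 1 ≤ map φ (𝓝 1)`: indeed `𝓝 1 = map (φ ∘ s) (𝓝 1) = map φ (map s (𝓝 1))` and `map s (𝓝 1) ≤ 𝓝 (s 1) = 𝓝 1` by continuity of `s`.
[cite: VignerasLNM800, Ch. II §4 («Mesures compatibles»)] [cite: DeitmarEchterhoff2014, Thm. 1.5.3] -/
theorem nhds_one_le_map_of_section {G Q : Type} [Group G] [TopologicalSpace G] [Group Q] [TopologicalSpace Q]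
    (φ : G →* Q) (s : Q →* G) (hs : Continuous s) (hφs : ∀ q, φ (s q) = q) :
    𝓝 (1 : Q) ≤ map φ (𝓝 (1 : G)) := by
  have h1 : Tendsto s (𝓝 (1 : Q)) (𝓝 (1 : G)) := by
    simpa only [map_one] using hs.tendsto (1 : Q)
  calc 𝓝 (1 : Q) = map (φ ∘ s) (𝓝 (1 : Q)) := by simp only [Function.comp_def, hφs, map_id']
    _ = map φ (map s (𝓝 (1 : Q))) := map_map.symm
    _ ≤ map φ (𝓝 (1 : G)) := map_mono h1

/-- **FILE `K2E5HaarIsOpenMapOfSection` — socket `HaarFibration.sig_K2E5HaarIsOpenMapOfSection` proved, statement token for token.**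
A continuous homomorphism `φ : G →* Q` of topological groups admitting a continuous homomorphic section `s : Q →* G` (`φ (s q) = q`) is an
OPEN MAP.  Printed: «soit `φ` un homomorphisme … admettant une section continue; `φ` est ouvert».  Proof: Mathlib's
`IsTopologicalGroup.isOpenMap_iff_nhds_one` (a homomorphism out of a topological group is open iff `𝓝 1 ≤ map φ (𝓝 1)`) and
`nhds_one_le_map_of_section`.  The continuity hypothesis on `φ` is part of the frozen socket and is not used.
[cite: VignerasLNM800, Ch. II §4 («Mesures compatibles»)] [cite: DeitmarEchterhoff2014, Thm. 1.5.3] -/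
theorem isOpenMapOfSection :
    ∀ {G Q : Type} [Group G] [TopologicalSpace G] [IsTopologicalGroup G] [Group Q] [TopologicalSpace Q] [IsTopologicalGroup Q]
      (φ : G →* Q) (_ : Continuous φ) (s : Q →* G) (_ : Continuous s) (_ : ∀ q, φ (s q) = q),
      IsOpenMap φ := by
  intro G Q _ _ _ _ _ _ φ _ s hs hφs
  rw [IsTopologicalGroup.isOpenMap_iff_nhds_one]
  exact nhds_one_le_map_of_section φ s hs hφs

end Summit.HodgeConjecture.HodgeConjecture.Cruxes.H413.K2E5HaarIsOpenMapOfSection
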